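import Mathlib
import Literature.NumberTheory.LFunctions.Zhang2022.Section11AFEWideTail
import Literature.NumberTheory.LFunctions.Zhang2022.Section11AFEWideWindow
import Literature.NumberTheory.LFunctions.Zhang2022.Section11AFEWideBlocks
import HarnessLib

/-!
# Zhang (2022) §11, proof of Lemma 11.2 for `χψ`: the repaired display `Z22:§11.u024` on the WIDENED
# height range `|t − 2πt₀| < 𝓛₁ + 2` (`step11u024e_wide2`, `step11u024e_wide`)

Topic `Literature/NumberTheory/LFunctions/Zhang2022` (Landau–Siegel audit tree; verdict-neutral).
Y. Zhang, *Discrete mean estimates and the Landau–Siegel zero*, arXiv:2211.02515v1 (2022)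
[Zhang2022LandauSiegel] — **an unrefereed manuscript under adjudication** (campaign D-0069 /
ZHANG-L discharge lane, WP12 helper H2-B; nothing here bears on Theorems 1–2 or on Landau–Siegel
zeros). Companion of `Section11AFEAssembly` / `Section11AFEWindowMove` (`step11u024e_holds`: the
repaired first display of the proof of Lemma 11.2, node `Z22:§11.u024`, on `Section11AFE.InRange112`).

WHAT. The SAME display — "`Σ_n χψ(n)n^{−s}g(P^z/n) = L(s,χψ) − Z(s,χψ)Σ_n χψ̄(n)n^{−(1−s)}g(P^{1−z}Dt₀/n)
+ O(E₂(s,ψ) + e^{−c𝓛¹⁰})`", `σ = 1/2`, `0.5 ≤ z ≤ 0.504`, `D` large, `ψ ∈ Ψ` — for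
`|t − 2πt₀| < 𝓛₁ + 2` (`step11u024e_wide2`) and, as a corollary, for `|t − 2πt₀| < 𝓛₁ + 1`
(`step11u024e_wide`, the shape asked for by the §12 consumer; the narrow `step11u024e_holds` is the
special case `𝓛₁`). Everything else is VERBATIM the text of
`Section11AFE.Step11u024e` (same `∃ c C`, `ForAllLarge`, idle `(A)`, same two sides and bound).

WHY. §12 p. 67 (tex L3426–3429, node `Z22:§12.u009`, `Typed.Sec12A.Htilde15ApproxFE`): "Using the
proof of Lemma 11.2 with `s + β₆` in place of `s` we deduce that `H̃₁₅(s,ψ) = …`", applied at the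
zeros `ρ ∈ 𝔷(ψ)` (`|Im ρ − 2πt₀| < 𝓛₁`); with `β₆ = 3iα/2` the point `ρ + β₆` leaves `InRange112` by up
to `3α/2`. The §11 proof uses the height only through Lemma 5.1/6.1's ranges (`𝓛₁ + 2`) and soft bounds
(`4𝓛⁵¹⁹ ≤ t − 𝓛²⁰`, `t ≤ 8𝓛⁵¹⁹`, `t > 0`): the companions `Section11AFEWideTailTools/WideTail`
((d), (6.2)), `Section11AFEWideWindowCore/WideWindow` ((f), (6.5)), `Section11AFEWideBlocks`
((b), (c), (g), (B2)) re-run those steps verbatim on the widened range; this file is the assembly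
(twin of `Section11AFEAssembly.step11u024e_of`). Theorem-only; 0 new definitions, 0 new facts.
Consumer: `Zhang2022/Section12Htilde15AFE.lean` (zl-libB-p8, the `H̃₁₅` approximate functional
equation in the repaired `+e^{−c𝓛¹⁰}` form taken by `Typed.Sec12A.eq128_of_sj_small`).

## References

* Y. Zhang, arXiv:2211.02515v1 (2022), §11 Lemma 11.2 (proof) p. 65, tex L3329–3331; §6 proof of
  Lemma 6.1 pp. 31–32; §12 p. 67, tex L3426–3429. [cite: Zhang2022LandauSiegel, §11 Lemma 11.2; §12 p.67]
-/

noncomputable section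

open Complex Real ComplexConjugate MeasureTheory Set Filter Topology

namespace Literature.NumberTheory.LFunctions.Zhang2022.Section11AFE

open Skeleton GaussWeight Section6Statements

section AssemblyWide

variable {D : ℕ} [NeZero D] (χ : DirichletCharacter ℂ D) (x : Chr D)

omit [NeZero D] in
/-- Monotonicity of `e^{−c𝓛¹⁰}` in `c`. [folklore] -/
private theorem exp_mono_c' {c c' L : ℝ} (h : c ≤ c') (hL : 0 ≤ L) :
    Real.exp (-c' * L) ≤ Real.exp (-c * L) :=
  Real.exp_le_exp.mpr (by nlinarith)

/-- **`Z22:§11.u024` (repaired) on the widened height range `|t − 2πt₀| < 𝓛₁ + 2`** (twin of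
`step11u024e_holds` / `Section11AFEAssembly.step11u024e_of`): for `D` large, `ψ ∈ Ψ`, `σ = 1/2`,
`|t − 2πt₀| < 𝓛₁ + 2`, `0.5 ≤ z ≤ 0.504`,
`‖Σ_nχψ(n)n^{−s}g(P^z/n) − (L(s,χψ) − Z(s,χψ)Σ_nχψ̄(n)n^{−(1−s)}g(P^{1−z}Dt₀/n))‖ ≤ C(E₂(s,ψ) + e^{−c𝓛¹⁰})`
— from (b) `shiftPole11_wide`, (c) `lineSplit11_wide`, (d) `tailSmall11_wide`, (f) `windowMove11_wide`,
(g) `dualTail11_wide`, (a) `vline_one_eq_smoothedSum`, (e) `vline_integrandMain`,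
(B2) `norm_vseg_integrandDiff_le_wide`. [cite: Zhang2022LandauSiegel, §11 Lemma 11.2 (proof), p. 65; §12 p. 67] -/
theorem step11u024e_wide2 :
    ∃ c : ℝ, 0 < c ∧ ∃ C : ℝ, ForAllLarge fun D _ χ => AssumptionA D χ → ∀ x : Chr D, ∀ s : ℂ,
      s.re = 1 / 2 → |s.im - 2 * π * t0 D| < ell1 D + 2 → ∀ z : ℝ, 0.5 ≤ z → z ≤ 0.504 →
        ‖(∑' n : ℕ, pc χ x n * (n : ℂ) ^ (-s) * (gW D (bigP D ^ z / (n : ℝ)) : ℂ)) -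
            ((psiChi χ x).LFunction s -
              Zpc χ x s * ∑' n : ℕ, conj (pc χ x n) * (n : ℂ) ^ (-(1 - s)) *
                (gW D (bigP D ^ (1 - z) * (D : ℝ) * t0 D / (n : ℝ)) : ℂ))‖
          ≤ C * (E2main χ x s + Real.exp (-c * ell D ^ 10)) := by
  obtain ⟨cd, hcd, Cd, Dd, hd⟩ := tailSmall11_wide
  obtain ⟨cf, hcf, Cf, Df, hf⟩ := windowMove11_wide
  obtain ⟨cg, hcg, Cg, Dg, hg⟩ := dualTail11_wide
  obtain ⟨Cw, Dw, hw⟩ := norm_vseg_integrandDiff_le_wide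
  obtain ⟨Db, hb⟩ := shiftPole11_wide
  obtain ⟨Dc, hc⟩ := lineSplit11_wide
  set c : ℝ := min cd (min cf cg) with hcdef
  have hc0 : 0 < c := lt_min hcd (lt_min hcf hcg)
  refine ⟨c, hc0, |Cd| + |Cf| + |Cg| + |Cw|,
    max (max (max Dd Df) (max Dg Dw)) (max (max Db Dc) 3), fun D _ χ hD hq hp _hA x s hre him z hz1 hz2 => ?_⟩
  -- thresholds
  have hDd : Dd ≤ D := le_trans (le_trans (le_max_left _ _) (le_max_left _ _)) (le_trans (le_max_left _ _) hD)
  have hDf : Df ≤ D := le_trans (le_trans (le_max_right _ _) (le_max_left _ _)) (le_trans (le_max_left _ _) hD)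
  have hDg : Dg ≤ D := le_trans (le_trans (le_max_left _ _) (le_max_right _ _)) (le_trans (le_max_left _ _) hD)
  have hDw : Dw ≤ D := le_trans (le_trans (le_max_right _ _) (le_max_right _ _)) (le_trans (le_max_left _ _) hD)
  have hDb : Db ≤ D := le_trans (le_trans (le_max_left _ _) (le_max_left _ _)) (le_trans (le_max_right _ _) hD)
  have hDc : Dc ≤ D := le_trans (le_trans (le_max_right _ _) (le_max_left _ _)) (le_trans (le_max_right _ _) hD)
  have hD3 : 3 ≤ D := le_trans (le_max_right _ _) (le_trans (le_max_right _ _) hD)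
  have hD2 : 2 ≤ D := le_trans (by norm_num) hD3
  -- positivity of the parameters
  have hP : 0 < bigP D := Real.exp_pos _
  have hX : 0 < bigP D ^ z := Real.rpow_pos_of_pos hP z
  have hℓ : 0 < ell D := by
    have : (1 : ℝ) < D := by exact_mod_cast lt_of_lt_of_le (by norm_num) hD2
    exact Real.log_pos this
  have hR : 0 < bigR D := by
    rw [bigR]
    have : (0 : ℝ) < D := by exact_mod_cast lt_of_lt_of_le (by norm_num) hD2
    exact mul_pos (mul_pos this hP) (pow_pos hℓ _)
  have hs0 : s ≠ 0 := by
    intro h; rw [h] at hre; norm_num at hre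
  have hsre : 0 < s.re := by rw [hre]; norm_num
  -- the pieces
  have ea := vline_one_eq_smoothedSum χ x hD2 hsre hs0 hX
  have eb := hb D χ hDb hq hp x s hre z hz1 hz2
  obtain ⟨ec1, ec2⟩ := hc D χ hDc hq hp x s hre z hz1 hz2
  have ee := vline_integrandMain χ x hD2 hX hR (Skeleton.P1 D) s
  have bd := hd D χ hDd hq hp x s hre him z hz1 hz2
  have bf := hf D χ hDf hq hp x s hre him z hz1 hz2
  have bg := hg D χ hDg hq hp x s hre him z hz1 hz2
  have bw := hw D χ hDw hq hp x s hre him (bigP D ^ z) hX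
  -- rewrite the target in terms of the objects of this file
  have hlhs : (∑' n : ℕ, pc χ x n * (n : ℂ) ^ (-s) * (gW D (bigP D ^ z / (n : ℝ)) : ℂ)) =
      smoothedSum χ x (bigP D ^ z) s := rfl
  have hdual : (∑' n : ℕ, conj (pc χ x n) * (n : ℂ) ^ (-(1 - s)) *
      (gW D (bigP D ^ (1 - z) * (D : ℝ) * t0 D / (n : ℝ)) : ℂ)) =
        dualSum χ x (bigR D / bigP D ^ z) s := by
    rw [dualSum, bigR_div_rpow]
  rw [hlhs, hdual]
  -- the exact identity behind the estimate
  set Sm := smoothedSum χ x (bigP D ^ z) s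
  set L0 := (psiChi χ x).LFunction s
  set Z0 := Zpc χ x s
  set dS := dualSum χ x (bigR D / bigP D ^ z) s
  set dH := dualHead χ x (bigR D / bigP D ^ z) (Skeleton.P1 D) s
  set vT := vline (integrandTail χ x (bigP D ^ z) (Skeleton.P1 D) s) (-1)
  set vD := vline (integrandDiff χ x (bigP D ^ z) (Skeleton.P1 D) s) (-1)
  set wD := vseg (integrandDiff χ x (bigP D ^ z) (Skeleton.P1 D) s) 0 (ell D ^ 20)
  have key : Sm - (L0 - Z0 * dS) = Z0 * (dS - dH) + (vD - wD) + wD + vT := by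
    rw [← ea, eb, ec1, ec2, ee]
    ring
  rw [key]
  -- the four error terms
  have hL10 : 0 ≤ ell D ^ 10 := pow_nonneg hℓ.le 10
  have e_d : Real.exp (-cd * ell D ^ 10) ≤ Real.exp (-c * ell D ^ 10) :=
    exp_mono_c' (le_trans (min_le_left _ _) le_rfl) hL10
  have e_f : Real.exp (-cf * ell D ^ 10) ≤ Real.exp (-c * ell D ^ 10) :=
    exp_mono_c' (le_trans (min_le_right _ _) (min_le_left _ _)) hL10
  have e_g : Real.exp (-cg * ell D ^ 10) ≤ Real.exp (-c * ell D ^ 10) :=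
    exp_mono_c' (le_trans (min_le_right _ _) (min_le_right _ _)) hL10
  have hE0 : 0 ≤ E2main χ x s := E2main_nonneg χ x s
  have hε0 : 0 ≤ Real.exp (-c * ell D ^ 10) := Real.exp_nonneg _
  calc ‖Z0 * (dS - dH) + (vD - wD) + wD + vT‖
      ≤ ‖Z0 * (dS - dH)‖ + ‖vD - wD‖ + ‖wD‖ + ‖vT‖ := by
        refine le_trans (norm_add_le _ _) ?_
        gcongr
        refine le_trans (norm_add_le _ _) ?_
        gcongr
        exact norm_add_le _ _
    _ ≤ Cg * Real.exp (-cg * ell D ^ 10) + Cf * Real.exp (-cf * ell D ^ 10) +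
          Cw * E2main χ x s + Cd * Real.exp (-cd * ell D ^ 10) :=
        add_le_add (add_le_add (add_le_add bg bf) bw) bd
    _ ≤ |Cg| * Real.exp (-c * ell D ^ 10) + |Cf| * Real.exp (-c * ell D ^ 10) +
          |Cw| * E2main χ x s + |Cd| * Real.exp (-c * ell D ^ 10) := by
        have t1 : Cg * Real.exp (-cg * ell D ^ 10) ≤ |Cg| * Real.exp (-c * ell D ^ 10) :=
          (mul_le_mul_of_nonneg_right (le_abs_self _) (Real.exp_nonneg _)).trans
            (mul_le_mul_of_nonneg_left e_g (abs_nonneg _))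
        have t2 : Cf * Real.exp (-cf * ell D ^ 10) ≤ |Cf| * Real.exp (-c * ell D ^ 10) :=
          (mul_le_mul_of_nonneg_right (le_abs_self _) (Real.exp_nonneg _)).trans
            (mul_le_mul_of_nonneg_left e_f (abs_nonneg _))
        have t3 : Cw * E2main χ x s ≤ |Cw| * E2main χ x s :=
          mul_le_mul_of_nonneg_right (le_abs_self _) hE0
        have t4 : Cd * Real.exp (-cd * ell D ^ 10) ≤ |Cd| * Real.exp (-c * ell D ^ 10) :=
          (mul_le_mul_of_nonneg_right (le_abs_self _) (Real.exp_nonneg _)).trans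
            (mul_le_mul_of_nonneg_left e_d (abs_nonneg _))
        linarith
    _ ≤ (|Cd| + |Cf| + |Cg| + |Cw|) * (E2main χ x s + Real.exp (-c * ell D ^ 10)) := by
        nlinarith [abs_nonneg Cd, abs_nonneg Cf, abs_nonneg Cg, abs_nonneg Cw]

/-- **`Z22:§11.u024` (repaired) on `|t − 2πt₀| < 𝓛₁ + 1`** — the shape of record asked for by the §12
consumer (`Section12Htilde15AFE`, the `H̃₁₅` approximate functional equation at `s + β₆`): a corollary
of `step11u024e_wide2`. [cite: Zhang2022LandauSiegel, §11 Lemma 11.2 (proof), p. 65; §12 p. 67, tex L3426–3429] -/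
theorem step11u024e_wide :
    ∃ c : ℝ, 0 < c ∧ ∃ C : ℝ, ForAllLarge fun D _ χ => AssumptionA D χ → ∀ x : Chr D, ∀ s : ℂ,
      s.re = 1 / 2 → |s.im - 2 * π * t0 D| < ell1 D + 1 → ∀ z : ℝ, 0.5 ≤ z → z ≤ 0.504 →
        ‖(∑' n : ℕ, pc χ x n * (n : ℂ) ^ (-s) * (gW D (bigP D ^ z / (n : ℝ)) : ℂ)) -
            ((psiChi χ x).LFunction s -
              Zpc χ x s * ∑' n : ℕ, conj (pc χ x n) * (n : ℂ) ^ (-(1 - s)) *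
                (gW D (bigP D ^ (1 - z) * (D : ℝ) * t0 D / (n : ℝ)) : ℂ))‖
          ≤ C * (E2main χ x s + Real.exp (-c * ell D ^ 10)) := by
  obtain ⟨c, hc, C, D₀, h⟩ := step11u024e_wide2
  exact ⟨c, hc, C, D₀, fun D _ χ hD hq hp hA x s hre him z hz1 hz2 =>
    h D χ hD hq hp hA x s hre (by linarith) z hz1 hz2⟩

end AssemblyWide

end Literature.NumberTheory.LFunctions.Zhang2022.Section11AFE
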